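import Literature.LinearAlgebra.Matrix.SecondOrderDampedTypeCount
import Literature.MathematicalPhysics.PowerSystems.StructurePreservingSyncExponentialStability
import Literature.MathematicalPhysics.PowerSystems.DroopKuramotoTypeCount
import HarnessLib

/-!
# The TYPE of an equilibrium of the structure-preserving (Bergen–Hill) model: the number of
# right-half-plane eigenvalues of the mixed first/second-order Jacobian is the index of the reduced
# Hessian `L(δ)` (Dörfler–Bullo 2011, Theorem 5.1 (2) / 5.3 for the multi-rate Kuramoto model)

Topic `Literature/MathematicalPhysics/PowerSystems`, namespace
`Literature.MathematicalPhysics.PowerSystems.BergenHill` (LADDER-GRIDFUSION rung G3, model row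
«structure-preserving»; seat gridfusion-lit-2 g11).  Companion of
`StructurePreservingSyncExponentialStability.lean` (`BergenHill.spJac δ⁰` on the state space
`Fin n ⊕ Gen` — all bus angles and the generator speeds; §3–§6 there: the s.e.p. is locally
exponentially stable modulo the rotation, an equilibrium with a negative Hessian direction is unstable)
and of `ClassicalSwingTypeCount.lean` / `DroopKuramotoTypeCount.lean` (the type count for the purely
second-order and the purely first-order tiers).  This file is the MIXED tier: generators of second
order, frequency-dependent loads of first order — «the classic structure-preserving power network
model» is the multi-rate Kuramoto model of [DorflerBullo2011, §1 eq. (1.3)], and Theorem 5.1 (2) there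
(arXiv:1011.3878 p0018 L99–L106: «the inertia of the Jacobian of `𝓗_λ` is given by the inertia of
`−∇²H(x*)` and the corresponding center-eigenspace is given by the nullspace of `∇²H(x*)`») is the
type count, typed in matrix form in `Literature/LinearAlgebra/Matrix/SecondOrderDampedTypeCount.lean`
§7–§8 (`countP_roots_charpoly_mixedOrderJac_of_rowSum_zero`).  Here it is PACKAGED for the tree's
`BergenHill n` record:

* `mobility`, `sel`, **`spJac_eq_mixedOrderJac`** — `spJac δ⁰` IS the mixed-order Jacobian of
  (`L(δ⁰)`, `Δ_i = [M_i = 0]/D_i`, the generator selector, `M_G`, `D_G`).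
* **`countP_roots_charpoly_spJac`** — `b` symmetric, `D_i > 0`, a reference GENERATOR `g₀` at which
  the reduced linearised Laplacian `L(δ⁰)_ref` (row/column `g₀` deleted) is nonsingular: the complex
  characteristic roots of `spJac δ⁰` number `#{λ_k(L_ref) < 0}` with positive real part (the TYPE of
  `δ⁰`), `#{λ_k(L_ref) > 0} + |Gen|` with negative real part, and exactly ONE on the imaginary axis
  (the rotation `(𝟙, 0)`), counted with multiplicity.
* **`typeZero_spJac_of_posCurvature`** / **`typeZero_spJac_of_arc`** — the PSD + kernel certificate
  (e.g. `|δ⁰_i − δ⁰_j| < π/2` across the lines of a connected network, `posCurvature_of_arc`) gives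
  counts `(0, n − 1 + |Gen|, 1)`: a hyperbolic sink modulo the rotation (the spectral content of
  DCB2013 SI Lemma 1 / MTW2017 Lemma 1's stable clause for the mixed model);
  **`typeMax_spJac_of_negCurvature`** — a negative form off the constants gives `(n − 1, |Gen|, 1)`;
  `typeOne_spJac_of_card_neg_eq_one` — type one iff the reduced Laplacian has exactly one negative
  eigenvalue (the u.e.p.s of the controlling-u.e.p. method for network-preserving models).
* §3 **`countP_roots_charpoly_spJac_eq_auxJac`** — Theorem 5.3 (Synchronization Equivalence) in
  count form: the mixed-order Jacobian `spJac δ⁰` and the Jacobian `auxJac δ⁰ = −D⁻¹L(δ⁰)` of the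
  FIRST-ORDER variant (`toDroopNetwork`: every node `D_iδ̇_i = P⁰_i − Σ_j b_ij sin(δ_i − δ_j)`,
  `DroopKuramotoTypeCount.lean`) have the same number of roots with positive real part (the same
  TYPE), one root each on the imaginary axis, and `|Gen|` more stable roots for the mixed model («the
  corresponding Jacobians have the same inertia»); `typeZero_spJac_iff_typeZero_auxJac`.

Everything is PROVED (no named fact, no `sorry`); the hypotheses are finite checks (one exact `LDLᵀ`
of `L(δ⁰)_ref`).

THREE COLUMNS.  Statements about the linearisation of MODEL «structure-preserving (Bergen–Hill),
lossless, frequency-dependent loads, `|V| = 1`» at a rest point: «type», «hyperbolic» are properties of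
the MODEL's equilibria; no statement about a grid.  Not here: voltage dynamics / reactive power (the
DAE network-preserving models of [ZouYinChiang2003]-type results), transfer conductances.

## References
* F. Dörfler, F. Bullo, *On the critical coupling for Kuramoto oscillators*, SIAM J. Appl. Dyn. Syst.
  10 (2011) 1070–1099 = arXiv:1011.3878, §1 eq. (1.3), §5.1 Theorem 5.1 (2), §5.2 Theorem 5.3.
  [DorflerBullo2011]
* F. Dörfler, M. Chertkov, F. Bullo, PNAS 110 (2013), SI §2.4 (network-preserving model = coupled
  oscillator model), §3.1 Lemma 1 (arXiv:1208.0045 p0016 L11–L25: «its proof can be found in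
  [Theorems 5.1 and 5.3] of [DorflerBullo2011]»). [DorflerChertkovBullo2013]
* H.-D. Chiang, C.-C. Chu, G. Cauley, Proc. IEEE 83 (1995), §2 p. 46 (type-k), §6.3 Thm 6.1, §7
  (network-preserving models, p0083). [Chiang1995]
* D. Manik, M. Timme, D. Witthaut, Chaos 27 (2017) 083123, §2 Lemma 1. [ManikTimmeWitthaut2017]
* K. R. Padiyar, *Structure Preserving Energy Functions in Power Systems* (2013), §3.2 (the model).
  [Padiyar2013]

AI-produced formalisation (LADDER-GRIDFUSION seat gridfusion-lit-2 g11, 2026-08-28).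
-/

set_option autoImplicit false

noncomputable section

open Finset Matrix Polynomial Literature.LinearAlgebra.Matrix
open scoped Matrix BigOperators

namespace Literature.MathematicalPhysics.PowerSystems

namespace BergenHill

variable {n : ℕ} (S : BergenHill n)

/-! ## §1 `spJac` is a mixed first/second-order Jacobian -/

/-- The first-order mobilities of the structure-preserving model: `Δ_i = 1/D_i` at load buses
(`D_iδ̇_i = P⁰_i − Σ_j b_ij sin(δ_i − δ_j)`), `0` at generator internal nodes.
[cite: DorflerBullo2011, §1 eq. (1.3) (arXiv:1011.3878 p0003 L60–L79: «n − m first-order Kuramoto oscillators with multiple time constants»)] -/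
def mobility : Fin n → ℝ := fun i => if 0 < S.M i then 0 else (S.D i)⁻¹

/-- The selector coupling generator angles to their speeds: `T_{ig} = [i = g]`.
[cite: DorflerBullo2011, §5.1 (the family 𝓗_λ at λ = 0: `ẋ₂ = ∇₃H = x₃`)] -/
def sel : Matrix (Fin n) S.Gen ℝ := fun i g => if i = g.1 then 1 else 0

variable {S}

/-- **`spJac δ⁰` is the mixed-order Jacobian** of the data (`L(δ⁰)`, mobilities, selector,
`M_G`, `D_G`): `[[−diag(Δ)L(δ⁰), T], [−diag(M_G)⁻¹TᵀL(δ⁰), −diag(D_G/M_G)]]`.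
[cite: DorflerBullo2011, §5.1 proof of Theorem 5.1 (the Jacobian `J_λ(x*)`, λ = 0); DorflerChertkovBullo2013, SI §3.1 Lemma 1] -/
theorem spJac_eq_mixedOrderJac (δs : Fin n → ℝ) :
    S.spJac δs = mixedOrderJac (S.toDroopNetwork.lap δs) S.mobility S.sel (fun g => S.M g.1)
      (fun g => S.D g.1) := by
  ext a b
  rcases a with i | g <;> rcases b with j | g'
  · simp only [spJac, mixedOrderJac, Matrix.fromBlocks_apply₁₁, Matrix.of_apply, mobility]
    by_cases hi : 0 < S.M i
    · rw [if_pos hi, if_pos hi, zero_mul, neg_zero]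
    · rw [if_neg hi, if_neg hi]
      ring
  · simp only [spJac, mixedOrderJac, Matrix.fromBlocks_apply₁₂, sel]
  · simp only [spJac, mixedOrderJac, Matrix.fromBlocks_apply₂₁, Matrix.of_apply, sel]
    congr 1
    simp only [ite_mul, one_mul, zero_mul, Finset.sum_ite_eq', Finset.mem_univ, if_true]
  · simp only [spJac, mixedOrderJac, Matrix.fromBlocks_apply₂₂]

/-- `L(δ⁰)` is symmetric for symmetric `b`. [cite: DorflerChertkovBullo2013, SI §3.1 Lemma 2 (1) («`L(θ) = B diag(a_ij cos(θ_i − θ_j)) Bᵀ`»)] -/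
private theorem lap_isHermitian' (hb : ∀ i j, S.b i j = S.b j i) (δs : Fin n → ℝ) :
    (S.toDroopNetwork.lap δs).IsHermitian := by
  refine Matrix.IsHermitian.ext fun i j => ?_
  rw [star_trivial]
  exact DroopNetwork.lap_symm (N := S.toDroopNetwork) (fun i j => hb i j) δs j i

/-- Zero row sums of `L(δ⁰)` (rotational invariance). [cite: DorflerChertkovBullo2013, SI §3.1 proof of Lemma 2 («rotational symmetry»)] -/
private theorem sum_lap_row' (δs : Fin n → ℝ) (i : Fin n) : ∑ k, S.toDroopNetwork.lap δs i k = 0 := by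
  simp only [DroopNetwork.lap, Finset.sum_sub_distrib, Finset.sum_ite_eq, Finset.mem_univ, if_true,
    sub_self]

/-! ## §2 The type count -/

/-- **THE TYPE OF AN EQUILIBRIUM OF THE STRUCTURE-PRESERVING MODEL, modulo the rotation**
(Dörfler–Bullo Theorem 5.1 (2) / Theorem 5.3 for the multi-rate Kuramoto = network-preserving model).
Let `b` be symmetric, `D_i > 0` at every node, and `g₀` a reference GENERATOR at which the reduced
linearised Laplacian `L(δ⁰)_ref` (weights `b_ij cos(δ⁰_i − δ⁰_j)`, row and column `g₀` deleted) is
nonsingular.  Then the complex characteristic roots of the Jacobian `spJac δ⁰` on the state space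
`(δ, ω_G)` number exactly `#{negative eigenvalues of L(δ⁰)_ref}` with positive real part — the TYPE of
`δ⁰` —, exactly `#{positive eigenvalues of L(δ⁰)_ref} + |Gen|` with negative real part, and exactly ONE
on the imaginary axis (the rotation `(𝟙, 0)`), all counted with multiplicity: «the inertia of the
Jacobian … is given by the inertia of `−∇²H(x*)` and the corresponding center-eigenspace is given by
the nullspace of `∇²H(x*)`».  The hypotheses are finite checks (one exact `LDLᵀ` of `L(δ⁰)_ref`).
[cite: DorflerBullo2011, Theorem 5.1 (2) (arXiv:1011.3878 p0018 L99–L106) and Theorem 5.3, §1 eq. (1.3) («structure-preserving power network model»); DorflerChertkovBullo2013, SI §3.1 Lemma 1; Chiang1995, §2 (p. 46: type-k), §6.3 Theorem 6.1] -/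
theorem countP_roots_charpoly_spJac (hb : ∀ i j, S.b i j = S.b j i) (hD : ∀ i, 0 < S.D i)
    (δs : Fin n → ℝ) (g₀ : S.Gen)
    (hHm : (refMinor (S.toDroopNetwork.lap δs) g₀.1).IsHermitian)
    (hreg : ∀ u : {k : Fin n // k ≠ g₀.1} → ℝ, refMinor (S.toDroopNetwork.lap δs) g₀.1 *ᵥ u = 0 → u = 0) :
    ((S.spJac δs).map (algebraMap ℝ ℂ)).charpoly.roots.countP (fun μ => 0 < μ.re)
        = #{k | hHm.eigenvalues k < 0} ∧
      ((S.spJac δs).map (algebraMap ℝ ℂ)).charpoly.roots.countP (fun μ => μ.re < 0)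
        = #{k | 0 < hHm.eigenvalues k} + Fintype.card S.Gen ∧
      ((S.spJac δs).map (algebraMap ℝ ℂ)).charpoly.roots.countP (fun μ => μ.re = 0) = 1 := by
  have hL : (S.toDroopNetwork.lap δs).IsHermitian := lap_isHermitian' hb δs
  have hrow : ∀ i, ∑ k, S.toDroopNetwork.lap δs i k = 0 := sum_lap_row' δs
  have hΔ : ∀ k, 0 ≤ S.mobility k := by
    intro k
    simp only [mobility]
    split_ifs
    · exact le_rfl
    · exact (inv_pos.2 (hD k)).le
  have hM : ∀ g : S.Gen, 0 < S.M g.1 := fun g => g.2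
  have hDg : ∀ g : S.Gen, 0 < S.D g.1 := fun g => hD g.1
  have hi₀ : S.mobility g₀.1 = 0 := by simp [mobility, g₀.2]
  -- the covering condition of the reduced configuration
  have hcover : ∀ z : {k : Fin n // k ≠ g₀.1} → ℝ, (∀ k, S.mobility k.1 * z k = 0) →
      Matrix.vecMul z (mixedRefT S.sel g₀.1) = 0 → z = 0 := by
    intro z hz hzT
    funext k
    by_cases hk : 0 < S.M k.1
    · -- a generator `k ≠ g₀`: the speed column of `k` reads `z_k`
      have h := congrFun hzT ⟨k.1, hk⟩
      simp only [Matrix.vecMul, dotProduct, mixedRefT, sel, Pi.zero_apply] at h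
      have h1 : ∀ k' : {k : Fin n // k ≠ g₀.1},
          z k' * ((if k'.1 = k.1 then (1 : ℝ) else 0) - if g₀.1 = k.1 then 1 else 0)
            = if k' = k then z k' else 0 := by
        intro k'
        rw [if_neg (Ne.symm k.2)]
        by_cases hk' : k' = k
        · rw [if_pos hk', if_pos (congrArg Subtype.val hk')]; ring
        · have : k'.1 ≠ k.1 := fun e => hk' (Subtype.ext e)
          rw [if_neg hk', if_neg this]; ring
      simp only [h1, Finset.sum_ite_eq', Finset.mem_univ, if_true] at h
      exact h
    · -- a load: positive mobility
      have h := hz k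
      simp only [mobility, if_neg hk] at h
      rcases mul_eq_zero.1 h with h | h
      · exact absurd h (inv_ne_zero (hD k.1).ne')
      · exact h
  rw [spJac_eq_mixedOrderJac]
  exact countP_roots_charpoly_mixedOrderJac_of_rowSum_zero hL hrow hΔ S.sel hM hDg hi₀ hHm hreg hcover

/-! ## §3 Certificates: type `0` (the s.e.p.), maximal type, type one -/

/-- The quadratic form of `L(δ⁰)` is the printed Hessian form. [cite: DorflerChertkovBullo2013, SI §3.1 Lemma 2 (1)] -/
private theorem dotProduct_lap_mulVec (δs v : Fin n → ℝ) :
    v ⬝ᵥ (S.toDroopNetwork.lap δs *ᵥ v)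
      = ∑ i, v i * ∑ j, S.toDroopNetwork.linWeight δs i j * (v i - v j) := by
  simp only [dotProduct, DroopNetwork.lap_mulVec]

/-- **Type 0 — a hyperbolic sink modulo the rotation — from the PSD + kernel certificate** on the
Hessian form `u ↦ Σ_i u_i Σ_j b_ij cos(δ⁰_i − δ⁰_j)(u_i − u_j)` (`≥ 0`, kernel the constants; `b`
symmetric, `D > 0`, at least one generator `g₀`): counts `(0, n − 1 + |Gen|, 1)` — every characteristic
root of `spJac δ⁰` off the simple rotation root has negative real part (the spectral sentence behind
DCB2013 SI Lemma 1 ∧ Lemma 2 (2) / MTW2017 Lemma 1 (stable clause) for the MIXED model, now with the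
multiplicity count). [cite: DorflerBullo2011, Theorem 5.1 (2) and Theorem 5.3; DorflerChertkovBullo2013, SI §3.1 Lemma 1 and Lemma 2 (2); ManikTimmeWitthaut2017, §2 Lemma 1] -/
theorem typeZero_spJac_of_posCurvature (hb : ∀ i j, S.b i j = S.b j i) (hD : ∀ i, 0 < S.D i)
    {δs : Fin n → ℝ}
    (hpsd : ∀ u : Fin n → ℝ, 0 ≤ ∑ i, u i * ∑ j, S.toDroopNetwork.linWeight δs i j * (u i - u j))
    (hker : ∀ u : Fin n → ℝ, ∑ i, u i * ∑ j, S.toDroopNetwork.linWeight δs i j * (u i - u j) = 0 →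
      ∃ a : ℝ, u = fun _ => a) (g₀ : S.Gen) :
    ((S.spJac δs).map (algebraMap ℝ ℂ)).charpoly.roots.countP (fun μ => 0 < μ.re) = 0 ∧
      ((S.spJac δs).map (algebraMap ℝ ℂ)).charpoly.roots.countP (fun μ => μ.re < 0)
        = n - 1 + Fintype.card S.Gen ∧
      ((S.spJac δs).map (algebraMap ℝ ℂ)).charpoly.roots.countP (fun μ => μ.re = 0) = 1 := by
  classical
  have hL : (S.toDroopNetwork.lap δs).IsHermitian := lap_isHermitian' hb δs
  have hform : ∀ v : Fin n → ℝ, (∃ i j, v i ≠ v j) → 0 < v ⬝ᵥ (S.toDroopNetwork.lap δs *ᵥ v) := by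
    intro v hv
    rw [dotProduct_lap_mulVec]
    refine lt_of_le_of_ne (hpsd v) fun h => ?_
    obtain ⟨a, ha⟩ := hker v h.symm
    obtain ⟨i, j, hij⟩ := hv
    exact hij (by rw [ha])
  have hHm : (refMinor (S.toDroopNetwork.lap δs) g₀.1).IsHermitian := refMinor_isHermitian hL g₀.1
  have hpos := refMinor_pos_of_form_pos hform g₀.1
  have hPD : (refMinor (S.toDroopNetwork.lap δs) g₀.1).PosDef :=
    Matrix.PosDef.of_dotProduct_mulVec_pos hHm hpos
  have hreg : ∀ u : {k : Fin n // k ≠ g₀.1} → ℝ,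
      refMinor (S.toDroopNetwork.lap δs) g₀.1 *ᵥ u = 0 → u = 0 := by
    intro u hu
    by_contra hne
    have h := hpos u hne
    rw [hu, dotProduct_zero] at h
    exact lt_irrefl _ h
  obtain ⟨h1, h2, h3⟩ := countP_roots_charpoly_spJac hb hD δs g₀ hHm hreg
  refine ⟨?_, ?_, h3⟩
  · rw [h1, Finset.card_eq_zero, Finset.filter_eq_empty_iff]
    intro k _
    exact not_lt.2 (hPD.eigenvalues_pos k).le
  · rw [h2]
    have hall : (Finset.univ.filter fun k => 0 < hHm.eigenvalues k) = Finset.univ :=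
      Finset.filter_true_of_mem fun k _ => hPD.eigenvalues_pos k
    rw [hall, Finset.card_univ, Fintype.card_subtype_compl, Fintype.card_subtype_eq, Fintype.card_fin]

/-- **Type 0 on the arc** — the hypothesis of DCB2013 SI Lemma 2 (2): `b ≥ 0` symmetric with a
connected coupling graph, `|δ⁰_i − δ⁰_j| < π/2` across every line, `D > 0`, at least one generator:
counts `(0, n − 1 + |Gen|, 1)`. [cite: DorflerChertkovBullo2013, SI §3.1 Lemma 1 with Lemma 2 (2); DorflerBullo2011, Theorem 5.3 (iii)] -/
theorem typeZero_spJac_of_arc (hb : ∀ i j, S.b i j = S.b j i) (hb0 : ∀ i j, 0 ≤ S.b i j)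
    (hconn : ClassicalModel.CouplingConnected S.b) (hD : ∀ i, 0 < S.D i) {δs : Fin n → ℝ}
    (harc : ∀ i j, i ≠ j → 0 < S.b i j → |δs i - δs j| < Real.pi / 2) (g₀ : S.Gen) :
    ((S.spJac δs).map (algebraMap ℝ ℂ)).charpoly.roots.countP (fun μ => 0 < μ.re) = 0 ∧
      ((S.spJac δs).map (algebraMap ℝ ℂ)).charpoly.roots.countP (fun μ => μ.re < 0)
        = n - 1 + Fintype.card S.Gen ∧
      ((S.spJac δs).map (algebraMap ℝ ℂ)).charpoly.roots.countP (fun μ => μ.re = 0) = 1 := by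
  obtain ⟨hpsd, hker⟩ := posCurvature_of_arc hb hb0 hconn harc
  exact typeZero_spJac_of_posCurvature hb hD hpsd hker g₀

/-- **Maximal type**: if the Hessian form is NEGATIVE on every non-constant direction, the counts are
`(n − 1, |Gen|, 1)` — every transversal configuration direction is unstable, only the `|Gen|` speed
decay modes are stable. [cite: DorflerBullo2011, Theorem 5.1 (2); Chiang1995, §2 (type-k); ManikTimmeWitthaut2017, §2 Lemma 1 (unstable direction)] -/
theorem typeMax_spJac_of_negCurvature (hb : ∀ i j, S.b i j = S.b j i) (hD : ∀ i, 0 < S.D i)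
    {δs : Fin n → ℝ}
    (hform : ∀ v : Fin n → ℝ, (∃ i j, v i ≠ v j) →
      ∑ i, v i * ∑ j, S.toDroopNetwork.linWeight δs i j * (v i - v j) < 0) (g₀ : S.Gen) :
    ((S.spJac δs).map (algebraMap ℝ ℂ)).charpoly.roots.countP (fun μ => 0 < μ.re) = n - 1 ∧
      ((S.spJac δs).map (algebraMap ℝ ℂ)).charpoly.roots.countP (fun μ => μ.re < 0)
        = Fintype.card S.Gen ∧
      ((S.spJac δs).map (algebraMap ℝ ℂ)).charpoly.roots.countP (fun μ => μ.re = 0) = 1 := by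
  classical
  have hL : (S.toDroopNetwork.lap δs).IsHermitian := lap_isHermitian' hb δs
  have hform' : ∀ v : Fin n → ℝ, (∃ i j, v i ≠ v j) → v ⬝ᵥ (S.toDroopNetwork.lap δs *ᵥ v) < 0 := by
    intro v hv
    rw [dotProduct_lap_mulVec]
    exact hform v hv
  have hHm : (refMinor (S.toDroopNetwork.lap δs) g₀.1).IsHermitian := refMinor_isHermitian hL g₀.1
  have hneg := refMinor_neg_of_form_neg hform' g₀.1
  have hreg : ∀ u : {k : Fin n // k ≠ g₀.1} → ℝ,
      refMinor (S.toDroopNetwork.lap δs) g₀.1 *ᵥ u = 0 → u = 0 := by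
    intro u hu
    by_contra hne
    have h := hneg u hne
    rw [hu, dotProduct_zero] at h
    exact lt_irrefl _ h
  -- eigenvalues of `L_ref` are all negative: `L_ref v = λ v`, `v ≠ 0` ⇒ `λ‖v‖² = vᵀL_ref v < 0`
  have hev : ∀ k, hHm.eigenvalues k < 0 := by
    intro k
    have hv := hHm.mulVec_eigenvectorBasis k
    set v : {j : Fin n // j ≠ g₀.1} → ℝ := ⇑(hHm.eigenvectorBasis k) with hvdef
    have hv0 : v ≠ 0 := by
      intro h
      have := (hHm.eigenvectorBasis).orthonormal.ne_zero k
      apply this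
      exact (WithLp.ofLp_eq_zero 2).1 h
    have h1 := hneg v hv0
    rw [hv, dotProduct_smul, smul_eq_mul] at h1
    have h2 : 0 < v ⬝ᵥ v := by
      rw [dotProduct]
      obtain ⟨a, ha⟩ : ∃ a, v a ≠ 0 := by
        by_contra h; push Not at h; exact hv0 (funext h)
      exact lt_of_lt_of_le (mul_self_pos.2 ha)
        (Finset.single_le_sum (f := fun b => v b * v b) (fun b _ => mul_self_nonneg _) (Finset.mem_univ a))
    by_contra hk
    push Not at hk
    have : 0 ≤ hHm.eigenvalues k * (v ⬝ᵥ v) := mul_nonneg hk h2.le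
    linarith
  obtain ⟨h1, h2, h3⟩ := countP_roots_charpoly_spJac hb hD δs g₀ hHm hreg
  refine ⟨?_, ?_, h3⟩
  · rw [h1]
    have hall : (Finset.univ.filter fun k => hHm.eigenvalues k < 0) = Finset.univ :=
      Finset.filter_true_of_mem fun k _ => hev k
    rw [hall, Finset.card_univ, Fintype.card_subtype_compl, Fintype.card_subtype_eq, Fintype.card_fin]
  · rw [h2, Finset.card_eq_zero.2 (Finset.filter_eq_empty_iff.2 fun k _ => not_lt.2 (hev k).le),
      zero_add]

/-- **Type one**: exactly ONE negative eigenvalue of the reduced linearised Laplacian (and none zero)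
makes `δ⁰` a hyperbolic TYPE-ONE equilibrium of the structure-preserving model — exactly one
characteristic root with positive real part, the rotation root, all others in the open left half plane
(the objects of the controlling-u.e.p. method for network-preserving models).
[cite: Chiang1995, §2 (p. 46: type-one), §7 (network-preserving models, p0083); DorflerBullo2011, Theorem 5.1 (2)] -/
theorem typeOne_spJac_of_card_neg_eq_one (hb : ∀ i j, S.b i j = S.b j i) (hD : ∀ i, 0 < S.D i)
    (δs : Fin n → ℝ) (g₀ : S.Gen)
    (hHm : (refMinor (S.toDroopNetwork.lap δs) g₀.1).IsHermitian)
    (hreg : ∀ u : {k : Fin n // k ≠ g₀.1} → ℝ, refMinor (S.toDroopNetwork.lap δs) g₀.1 *ᵥ u = 0 → u = 0)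
    (hone : #{k | hHm.eigenvalues k < 0} = 1) :
    ((S.spJac δs).map (algebraMap ℝ ℂ)).charpoly.roots.countP (fun μ => 0 < μ.re) = 1 ∧
      ((S.spJac δs).map (algebraMap ℝ ℂ)).charpoly.roots.countP (fun μ => μ.re = 0) = 1 := by
  obtain ⟨h1, -, h3⟩ := countP_roots_charpoly_spJac hb hD δs g₀ hHm hreg
  exact ⟨h1.trans hone, h3⟩

/-! ## §3 Theorem 5.3 (Synchronization Equivalence): the mixed model and its first-order variant have
the same type -/

/-- **Dörfler–Bullo Theorem 5.3 (Synchronization Equivalence), spectral content, for the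
structure-preserving model.**  The mixed first/second-order Jacobian `spJac δ⁰` (generator internal
nodes of second order, load buses of first order) and the Jacobian `auxJac δ⁰ = −D⁻¹L(δ⁰)` of the
FIRST-ORDER VARIANT of the network (every node `D_iδ̇_i = P⁰_i − Σ_j b_ij sin(δ_i − δ_j)` — the
data read as `toDroopNetwork`; [DorflerBullo2011, §5.2 eq. (1st order multi-rate Kuramoto model)])
have THE SAME NUMBER of characteristic roots with positive real part (the same TYPE of `δ⁰`), each
exactly ONE root on the imaginary axis (the rotation), and the mixed model has exactly `|Gen|` more
roots with negative real part (the printed frequency dynamics `(d/dt)θ̇_i = −M_i⁻¹D_iθ̇_i` supply the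
`m` extra stable directions of the first-order variant): «the corresponding Jacobians have the same
inertia and local exponential stability of one system implies local exponential stability of the other
system».  Hypotheses: `b` symmetric, `D_i > 0`, a reference generator `g₀` with `L(δ⁰)_ref`
nonsingular (finite checks).  The topological-conjugacy clause of Theorem 5.3 is NOT typed.
[cite: DorflerBullo2011, §5.2 Theorem 5.3 («(i) ⇔ (ii) ⇔ (iii)») and its proof (arXiv:1011.3878 p0021 L25–L34, p0022 L1: «by Theorem 5.1, the corresponding Jacobians have the same inertia»); DorflerChertkovBullo2013, SI §3.1 Lemma 1 («[Theorems 5.1 and 5.3]»)] -/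
theorem countP_roots_charpoly_spJac_eq_auxJac (hb : ∀ i j, S.b i j = S.b j i) (hD : ∀ i, 0 < S.D i)
    (δs : Fin n → ℝ) (g₀ : S.Gen)
    (hHm : (refMinor (S.toDroopNetwork.lap δs) g₀.1).IsHermitian)
    (hreg : ∀ u : {k : Fin n // k ≠ g₀.1} → ℝ, refMinor (S.toDroopNetwork.lap δs) g₀.1 *ᵥ u = 0 → u = 0) :
    ((S.spJac δs).map (algebraMap ℝ ℂ)).charpoly.roots.countP (fun μ => 0 < μ.re)
        = ((S.toDroopNetwork.auxJac δs).map (algebraMap ℝ ℂ)).charpoly.roots.countP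
            (fun μ => 0 < μ.re) ∧
      ((S.spJac δs).map (algebraMap ℝ ℂ)).charpoly.roots.countP (fun μ => μ.re < 0)
        = ((S.toDroopNetwork.auxJac δs).map (algebraMap ℝ ℂ)).charpoly.roots.countP
            (fun μ => μ.re < 0) + Fintype.card S.Gen ∧
      ((S.spJac δs).map (algebraMap ℝ ℂ)).charpoly.roots.countP (fun μ => μ.re = 0) = 1 ∧
      ((S.toDroopNetwork.auxJac δs).map (algebraMap ℝ ℂ)).charpoly.roots.countP
          (fun μ => μ.re = 0) = 1 := by
  obtain ⟨h1, h2, h3⟩ := countP_roots_charpoly_spJac hb hD δs g₀ hHm hreg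
  have hY : ∀ i j, S.toDroopNetwork.Yabs i j = S.toDroopNetwork.Yabs j i := hb
  have hD' : ∀ i, 0 < S.toDroopNetwork.Dc i := hD
  obtain ⟨k1, k2, k3⟩ :=
    DroopNetwork.countP_roots_charpoly_auxJac_modRotation hY hD' δs g₀.1 hHm hreg
  exact ⟨h1.trans k1.symm, by rw [h2, k2], h3, k3⟩

/-- **Theorem 5.3, stability clause in type form**: `δ⁰` is a hyperbolic sink modulo the rotation for
the structure-preserving model (no root with positive real part, one on the axis) IFF it is one for the
first-order variant — «local exponential stability of one system implies local exponential stability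
of the other system». [cite: DorflerBullo2011, §5.2 Theorem 5.3 («(i) ⇔ (ii)»)] -/
theorem typeZero_spJac_iff_typeZero_auxJac (hb : ∀ i j, S.b i j = S.b j i) (hD : ∀ i, 0 < S.D i)
    (δs : Fin n → ℝ) (g₀ : S.Gen)
    (hHm : (refMinor (S.toDroopNetwork.lap δs) g₀.1).IsHermitian)
    (hreg : ∀ u : {k : Fin n // k ≠ g₀.1} → ℝ, refMinor (S.toDroopNetwork.lap δs) g₀.1 *ᵥ u = 0 → u = 0) :
    ((S.spJac δs).map (algebraMap ℝ ℂ)).charpoly.roots.countP (fun μ => 0 < μ.re) = 0 ↔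
      ((S.toDroopNetwork.auxJac δs).map (algebraMap ℝ ℂ)).charpoly.roots.countP
        (fun μ => 0 < μ.re) = 0 := by
  rw [(countP_roots_charpoly_spJac_eq_auxJac hb hD δs g₀ hHm hreg).1]

end BergenHill

end Literature.MathematicalPhysics.PowerSystems

end
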